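import Literature.Probability.Percolation.QuadCrossingDuality
import Literature.Probability.Percolation.QuadCrossingPathCrossings
import Literature.Probability.Percolation.IsoradialPathCrossing
import Literature.Probability.Percolation.FourArmGarbanTwoArms
import HarnessLib

/-!
# Lattice and continuum lemmas for the undocked half-plane three-arm reduction

Serves the registered stub `stub_noTouch_undockedThreeArm` of crux stmt-CriticalPhenomena-10268
(line `hitting-tournament`) through its conditional form (the cluster-form half-plane three-arm
bound from the undocked half-plane two-arm bound).  The reduction extracts, from two open paths
of a half-annulus of `δℤ²` that are not joined inside it, a closed dual crossing of the
half-annulus by continuum planar duality in the polar half-annulus quad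
`[Q] = {a ≤ dist z c ≤ b, Im c ≤ Im z}` (`stub_undockedThreeArm_polarQuad`).  This file holds
the quad-independent lemmas, stated for an arbitrary quad with that carrier and those sides:

* `stub_undockedThreeArm_subwalk` — a lattice walk from the disc `dist ≤ a` to `dist ≥ b`
  contains a sub-walk from a vertex at distance `≤ a` to one at distance `≥ b` all of whose
  vertices are at distance in `(a - δ, b + δ)` (cut at the first exit, then at the last entry);
* `stub_undockedThreeArm_clip` — the drawn polyline of such a walk with vertices in rows
  `≥ k₀` (`c = δ c₀`, `k₀ = c₀ 1`) contains a continuum path in `[Q]` from `∂₁Q` (inner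
  semicircle) to `∂₃Q` (outer semicircle) inside the drawn edges of the walk
  (`exists_clip_Icc` on `t ↦ dist (γ t) c`);
* `stub_undockedThreeArm_noCrossing` — **the two-colour obstruction**: if `A`, `B` are sets of
  lattice edges no edge of `A` sharing a vertex with an edge of `B`, and `[Q]` is crossed from
  `∂₁Q` to `∂₃Q` both by a path inside the drawn edges of `A` and by one inside those of `B`,
  then `Q` has no Schramm–Smirnov crossing (from `∂₀Q` to `∂₂Q`) inside the drawn edges of
  `A ∪ B`: such a crossing, a continuum, meets both paths (`exists_mem_of_isPreconnected_crossing`)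
  but lies in one of the two disjoint closed sets `O_A`, `O_B` (distinct lattice edges meet only
  at common endpoints, `exists_eq_meshPoint_of_mem_segment_inter`).

References: O. Schramm, S. Smirnov, Ann. Probab. 39 (2011), §1.3 and proof of Lemma 6.1
[SchrammSmirnov2011]; G. Grimmett, *Percolation* (1999), §11.2 [GrimmettPercolation1999].
-/

noncomputable section

open Set Metric Complex SimpleGraph
open scoped unitInterval
open Literature.Probability.Percolation Literature.Probability.LatticeModels
open Literature.Probability.Percolation.QuadCrossing

namespace Summit.CriticalPhenomena.CardyFormulaZ2.Cruxes.LagHandOff.HittingTournament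

/-! ### Sub-walks crossing an annulus -/

/-- **A walk from the disc `dist ≤ a` to `dist ≥ b` around `c` (`a < b`) contains a sub-walk
from a vertex at distance `≤ a` to a vertex at distance `≥ b` all of whose vertices are at
distance in `(a - δ, b + δ)` from `c`** (same vertices and edges as sets, up to inclusion):
stop at the first vertex at distance `≥ b`, then start at the last vertex at distance `≤ a`.
[folklore] -/
theorem stub_undockedThreeArm_subwalk : ∀ {δ : ℝ} (c : ℂ) {a b : ℝ}, a < b →
    ∀ {u v : Site 2} (W : (zdGraph 2).Walk u v), dist (meshPoint δ u) c ≤ a →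
    b ≤ dist (meshPoint δ v) c →
    ∃ (x y : Site 2) (W' : (zdGraph 2).Walk x y), dist (meshPoint δ x) c ≤ a ∧
      b ≤ dist (meshPoint δ y) c ∧ (∀ z ∈ W'.support, z ∈ W.support) ∧
      (∀ e ∈ W'.edges, e ∈ W.edges) ∧
      ∀ z ∈ W'.support, a - |δ| < dist (meshPoint δ z) c ∧ dist (meshPoint δ z) c < b + |δ| := by
  intro δ c a b hab u v W hu hv
  have hstep : ∀ {p q : Site 2}, (zdGraph 2).Adj p q →
      dist (meshPoint δ q) c ≤ dist (meshPoint δ p) c + |δ| := fun {p q} hpq => by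
    have h1 : dist (meshPoint δ q) (meshPoint δ p) ≤ |δ| := by
      rw [dist_eq_norm]; exact norm_meshPoint_sub_meshPoint_le_of_adj δ hpq
    linarith [dist_triangle (meshPoint δ q) (meshPoint δ p) c]
  -- first exit from `{dist < b}`
  obtain ⟨x₁, z₁, q₁, hxz₁, hz₁, hq₁A, hq₁supp, hq₁edges, hlast₁⟩ :=
    exists_prefix_exit (A := {w : Site 2 | dist (meshPoint δ w) c < b}) W
      (show dist (meshPoint δ u) c < b by linarith) (show ¬ dist (meshPoint δ v) c < b by linarith)
  have hz₁b : b ≤ dist (meshPoint δ z₁) c := not_lt.1 hz₁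
  set W₁ : (zdGraph 2).Walk u z₁ := q₁.concat hxz₁ with hW₁
  have hW₁supp : ∀ w ∈ W₁.support, w ∈ W.support := by
    intro w hw
    rw [hW₁, Walk.support_concat, List.mem_append, List.mem_singleton] at hw
    rcases hw with hw | rfl
    · exact hq₁supp w hw
    · exact W.snd_mem_support_of_mem_edges hlast₁
  have hW₁edges : ∀ e ∈ W₁.edges, e ∈ W.edges := by
    intro e he
    rw [hW₁, Walk.edges_concat, List.concat_eq_append, List.mem_append, List.mem_singleton] at he
    rcases he with he | rfl
    · exact hq₁edges e he
    · exact hlast₁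
  have hW₁lt : ∀ w ∈ W₁.support, dist (meshPoint δ w) c < b + |δ| := by
    intro w hw
    rw [hW₁, Walk.support_concat, List.mem_append, List.mem_singleton] at hw
    rcases hw with hw | rfl
    · have : dist (meshPoint δ w) c < b := hq₁A w hw
      linarith [abs_nonneg δ]
    · have hx : dist (meshPoint δ x₁) c < b := hq₁A x₁ q₁.end_mem_support
      linarith [hstep hxz₁]
  -- last entry into `{dist ≤ a}`: first exit of the reversed walk from `{a < dist}`
  obtain ⟨x₂, z₂, q₂, hxz₂, hz₂, hq₂A, hq₂supp, hq₂edges, hlast₂⟩ :=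
    exists_prefix_exit (A := {w : Site 2 | a < dist (meshPoint δ w) c}) W₁.reverse
      (show a < dist (meshPoint δ z₁) c by linarith) (show ¬ a < dist (meshPoint δ u) c by linarith)
  have hz₂a : dist (meshPoint δ z₂) c ≤ a := not_lt.1 hz₂
  set W₂ : (zdGraph 2).Walk z₁ z₂ := q₂.concat hxz₂ with hW₂
  have hW₂supp : ∀ w ∈ W₂.support, w ∈ W₁.support := by
    intro w hw
    rw [hW₂, Walk.support_concat, List.mem_append, List.mem_singleton] at hw
    rcases hw with hw | rfl
    · have := hq₂supp w hw
      rwa [Walk.support_reverse, List.mem_reverse] at this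
    · have := W₁.reverse.snd_mem_support_of_mem_edges hlast₂
      rwa [Walk.support_reverse, List.mem_reverse] at this
  have hW₂edges : ∀ e ∈ W₂.edges, e ∈ W₁.edges := by
    intro e he
    rw [hW₂, Walk.edges_concat, List.concat_eq_append, List.mem_append, List.mem_singleton] at he
    rcases he with he | rfl
    · have := hq₂edges e he
      rwa [Walk.edges_reverse, List.mem_reverse] at this
    · have := hlast₂
      rwa [Walk.edges_reverse, List.mem_reverse] at this
  refine ⟨z₂, z₁, W₂.reverse, hz₂a, hz₁b, fun w hw => ?_, fun e he => ?_, fun w hw => ⟨?_, ?_⟩⟩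
  · rw [Walk.support_reverse, List.mem_reverse] at hw
    exact hW₁supp w (hW₂supp w hw)
  · rw [Walk.edges_reverse, List.mem_reverse] at he
    exact hW₁edges e (hW₂edges e he)
  · rw [Walk.support_reverse, List.mem_reverse, hW₂, Walk.support_concat, List.mem_append,
      List.mem_singleton] at hw
    rcases hw with hw | rfl
    · have : a < dist (meshPoint δ w) c := hq₂A w hw
      linarith [abs_nonneg δ]
    · have hx : a < dist (meshPoint δ x₂) c := hq₂A x₂ q₂.end_mem_support
      linarith [hstep hxz₂.symm]
  · rw [Walk.support_reverse, List.mem_reverse] at hw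
    exact hW₁lt w (hW₂supp w hw)

/-! ### Clipping the drawn polyline into the quad -/

/-- **The drawn polyline of a walk of the half-plane `{rows ≥ k₀}` from the disc `dist ≤ a` to
`dist ≥ b` around `c = δ c₀` (`k₀ = c₀ 1`, `0 < a < b`) contains a path of the closed half-annulus
`{a ≤ dist ≤ b, Im c ≤ Im}` from the inner to the outer semicircle, inside the drawn edges of the
walk** (clip the distance-to-`c` level of the polyline to `[a, b]`, `exists_clip_Icc`; the polyline
stays in the convex half-plane `{Im ≥ Im c}` containing the vertices). [cite: SchrammSmirnov2011, §1.3] -/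
theorem stub_undockedThreeArm_clip : ∀ {δ : ℝ}, 0 < δ → ∀ (c₀ : Site 2) {a b : ℝ}, a < b →
    ∀ {x y : Site 2} (W : (zdGraph 2).Walk x y), (∀ z ∈ W.support, c₀ 1 ≤ z 1) →
    dist (meshPoint δ x) (meshPoint δ c₀) ≤ a → b ≤ dist (meshPoint δ y) (meshPoint δ c₀) →
    ∃ β : ℝ → ℂ, ContinuousOn β (Icc 0 1) ∧
      (∀ t ∈ Icc (0 : ℝ) 1, a ≤ dist (β t) (meshPoint δ c₀) ∧ dist (β t) (meshPoint δ c₀) ≤ b ∧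
        (meshPoint δ c₀).im ≤ (β t).im) ∧
      dist (β 0) (meshPoint δ c₀) = a ∧ dist (β 1) (meshPoint δ c₀) = b ∧
      ∀ t ∈ Icc (0 : ℝ) 1, β t ∈ openEdgeUnion δ {e | e ∈ W.edges} := by
  intro δ hδ c₀ a b hab x y W hrow hx hy
  set c := meshPoint δ c₀ with hc
  have hnil : ¬ W.Nil := by
    intro hn
    have := hn.eq
    subst this
    linarith
  set γ := W.toCurve (meshPoint δ) with hγdef
  have hγO : range γ ⊆ openEdgeUnion δ {e | e ∈ W.edges} := by
    refine (range_toCurve_subset_iUnion (meshPoint δ) hnil).trans ?_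
    intro z hz
    simp only [mem_iUnion] at hz
    obtain ⟨d, hd, hz⟩ := hz
    exact mem_openEdgeUnion_iff.2 ⟨d.fst, d.snd, d.adj, List.mem_map.2 ⟨d, hd, rfl⟩, hz⟩
  have hγim : range γ ⊆ {z : ℂ | c.im ≤ z.im} := by
    refine range_toCurve_subset_of_convex _ W (convex_halfSpace_im_ge c.im) fun v hv => ?_
    show c.im ≤ (meshPoint δ v).im
    rw [hc, meshPoint_im, meshPoint_im]
    exact mul_le_mul_of_nonneg_left (by exact_mod_cast hrow v hv) hδ.le
  set Γ : ℝ → ℂ := fun t => γ (projIcc 0 1 zero_le_one t) with hΓ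
  have hΓc : Continuous Γ := γ.continuous.comp continuous_projIcc
  have hΓγ : ∀ t, Γ t ∈ range γ := fun t => ⟨_, rfl⟩
  set g : ℝ → ℝ := fun t => dist (Γ t) c with hg
  have hgc : Continuous g := hΓc.dist continuous_const
  have hΓ0 : Γ 0 = meshPoint δ x := by
    simp only [hΓ, projIcc_left]; exact Walk.toCurve_apply_zero _ _
  have hΓ1 : Γ 1 = meshPoint δ y := by
    simp only [hΓ, projIcc_right]; exact toCurve_one _ _
  obtain ⟨s₀, s₁, hs₀, hs₀₁, hs₁, hgs₀, hgs₁, hgI⟩ := exists_clip_Icc hgc.continuousOn hab.le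
    (by show dist (Γ 0) c ≤ a; rw [hΓ0]; exact hx) (by show b ≤ dist (Γ 1) c; rw [hΓ1]; exact hy)
  -- reparametrise `[s₀, s₁]` by `[0, 1]`
  set β : ℝ → ℂ := fun t => Γ (s₀ + t * (s₁ - s₀)) with hβ
  have hmem : ∀ t ∈ Icc (0 : ℝ) 1, s₀ + t * (s₁ - s₀) ∈ Icc s₀ s₁ := fun t ht => by
    obtain ⟨ht0, ht1⟩ := ht
    constructor <;> nlinarith
  refine ⟨β, (hΓc.comp (by fun_prop)).continuousOn, fun t ht => ?_, ?_, ?_, fun t ht => hγO (hΓγ _)⟩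
  · obtain ⟨h1, h2⟩ := hgI _ (hmem t ht)
    exact ⟨h1, h2, hγim (hΓγ _)⟩
  · show dist (Γ (s₀ + 0 * (s₁ - s₀))) c = a
    rw [zero_mul, add_zero]; exact hgs₀
  · show dist (Γ (s₀ + 1 * (s₁ - s₀))) c = b
    rw [one_mul, add_sub_cancel]; exact hgs₁

/-! ### The two-colour obstruction to crossings -/

/-- The drawn edges of a union of edge sets. [folklore] -/
theorem openEdgeUnion_union {δ : ℝ} (A B : BondConfig (Site 2)) :
    openEdgeUnion δ (A ∪ B) = openEdgeUnion δ A ∪ openEdgeUnion δ B := by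
  ext z
  simp only [mem_openEdgeUnion_iff, mem_union]
  constructor
  · rintro ⟨x, y, hxy, h | h, hz⟩
    · exact Or.inl ⟨x, y, hxy, h, hz⟩
    · exact Or.inr ⟨x, y, hxy, h, hz⟩
  · rintro (⟨x, y, hxy, h, hz⟩ | ⟨x, y, hxy, h, hz⟩)
    · exact ⟨x, y, hxy, Or.inl h, hz⟩
    · exact ⟨x, y, hxy, Or.inr h, hz⟩

/-- **Vertex-disjoint edge sets are drawn as disjoint plane sets** (`δ ≠ 0`): two distinct
lattice edges meet only at a common endpoint. [folklore] -/
theorem disjoint_openEdgeUnion {δ : ℝ} (hδ : δ ≠ 0) {A B : BondConfig (Site 2)}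
    (hAB : ∀ e ∈ A, ∀ e' ∈ B, ∀ v : Site 2, v ∈ e → v ∈ e' → False) :
    Disjoint (openEdgeUnion δ A) (openEdgeUnion δ B) := by
  rw [Set.disjoint_left]
  intro z hzA hzB
  obtain ⟨x, y, hxy, hA, hz⟩ := mem_openEdgeUnion_iff.1 hzA
  obtain ⟨x', y', hxy', hB, hz'⟩ := mem_openEdgeUnion_iff.1 hzB
  have hne : s(x, y) ≠ s(x', y') := fun h => hAB _ hA _ hB x (Sym2.mem_mk_left x y) (h ▸ Sym2.mem_mk_left x y)
  obtain ⟨v, -, hv, hv'⟩ := exists_eq_meshPoint_of_mem_segment_inter hδ hxy hxy' hne hz hz'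
  exact hAB _ hA _ hB v hv hv'

/-- **The two-colour obstruction.**  Let `Q` be a quad, `A`, `B` sets of lattice edges no edge of
`A` sharing a vertex with an edge of `B`, and suppose `[Q]` is crossed from `∂₁Q` to `∂₃Q` by a
path inside the drawn edges of `A` and by a path inside the drawn edges of `B`.  Then `Q` has no
crossing (from `∂₀Q` to `∂₂Q`) inside the drawn edges of `A ∪ B`: a crossing meets both paths
(Schramm–Smirnov's crossing lemma), but being connected it lies inside one of the two disjoint
closed sets `O_A`, `O_B`. [cite: SchrammSmirnov2011, proof of Lemma 6.1 (duality)] -/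
theorem stub_undockedThreeArm_noCrossing : ∀ {δ : ℝ}, 0 < δ → ∀ {D : Set ℂ} (Q : Quad D)
    {A B : BondConfig (Site 2)},
    (∀ e ∈ A, ∀ e' ∈ B, ∀ v : Site 2, v ∈ e → v ∈ e' → False) →
    ∀ {β₁ β₂ : ℝ → ℂ}, ContinuousOn β₁ (Icc 0 1) → MapsTo β₁ (Icc 0 1) Q.carrier →
    β₁ 0 ∈ Q.side 1 → β₁ 1 ∈ Q.side 3 → (∀ t ∈ Icc (0 : ℝ) 1, β₁ t ∈ openEdgeUnion δ A) →
    ContinuousOn β₂ (Icc 0 1) → MapsTo β₂ (Icc 0 1) Q.carrier →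
    β₂ 0 ∈ Q.side 1 → β₂ 1 ∈ Q.side 3 → (∀ t ∈ Icc (0 : ℝ) 1, β₂ t ∈ openEdgeUnion δ B) →
    ¬ ∃ K, Q.IsCrossing K ∧ K ⊆ openEdgeUnion δ (A ∪ B) := by
  intro δ hδ D Q A B hAB β₁ β₂ hβ₁c hβ₁Q hβ₁0 hβ₁1 hβ₁A hβ₂c hβ₂Q hβ₂0 hβ₂1 hβ₂B
  rintro ⟨K, ⟨hKc, hKconn, hKsub, hK0, hK2⟩, hKO⟩
  obtain ⟨t₁, ht₁, ht₁K⟩ := Q.exists_mem_of_isPreconnected_crossing hKc hKconn.isPreconnected hKsub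
    hK0 hK2 hβ₁c hβ₁Q hβ₁0 hβ₁1
  obtain ⟨t₂, ht₂, ht₂K⟩ := Q.exists_mem_of_isPreconnected_crossing hKc hKconn.isPreconnected hKsub
    hK0 hK2 hβ₂c hβ₂Q hβ₂0 hβ₂1
  have hcover : K ⊆ openEdgeUnion δ A ∪ openEdgeUnion δ B := by
    rw [← openEdgeUnion_union]; exact hKO
  obtain ⟨z, -, hzA, hzB⟩ := isPreconnected_closed_iff.1 hKconn.isPreconnected _ _
    (isClosed_openEdgeUnion hδ A) (isClosed_openEdgeUnion hδ B) hcover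
    ⟨β₁ t₁, ht₁K, hβ₁A t₁ ht₁⟩ ⟨β₂ t₂, ht₂K, hβ₂B t₂ ht₂⟩
  exact Set.disjoint_left.1 (disjoint_openEdgeUnion hδ.ne' hAB) hzA hzB

end Summit.CriticalPhenomena.CardyFormulaZ2.Cruxes.LagHandOff.HittingTournament
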